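import Mathlib
import Literature.Geometry.Riemannian.SphericalCylinderEntropy
import Literature.Geometry.Manifold.CylinderSlice
import Summits.SmoothPoincare4.SmoothPoincare4.Theorems.CylinderEntropyThinCrossSectionExistsStubKernelDomination
import HarnessLib

/-!
# `ballMass_slice_le`: the unit slice `S⁴ × {0}` has `1`-subspherical intrinsic ball mass

Registered sub-goal `ballMass_slice_le` of stub D (`stub_massSlackIntr`) of line `ball-mass-slack`
of the crux `CylinderEntropy.ThinCrossSectionExists` (`stmt-SmoothPoincare4-7633`), proved with its
registered statement verbatim.  In the round cylinder `N = S⁴ × ℝ = {z ∈ ℝ⁶ | ∑_{i<5} zᵢ² = 1}`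
with the closed intrinsic balls `B(q,r) = {y ∈ N | arccos(⟨y',q'⟩)² + (y₅ - q₅)² ≤ r²}`
(`⟨y',q'⟩ = ∑_{i<5} yᵢ qᵢ`) and the slice `T = {z ∈ N | z₅ = 0}`: for every `q ∈ N` and `r > 0`,
`μH⁴(T ∩ B(q,r)) ≤ μH⁴(T ∩ B(e₀,r))`, where `e₀ = (1,0,0,0,0,0)`.

Proof.  Let `v := q - q₅ e₅` (the point of the slice below `q`; `‖v‖ = 1 = ‖e₀‖`) and let `R` be
the Mathlib reflection `Submodule.reflection (ℝ ∙ (v - e₀))ᗮ`, a linear isometry of `ℝ⁶` with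
`R v = e₀` (`Submodule.reflection_sub`) which fixes `e₅ ⊥ v - e₀`
(`Submodule.reflection_mem_subspace_eq_self`).  Hence `R` preserves the height `y₅ = ⟪y, e₅⟫`,
preserves `∑_{i<5} yᵢ² = ‖y‖² - y₅²`, and `(R y)₀ = ⟪R y, R v⟫ = ⟪y, v⟫ = ⟨y', q'⟩`
(`LinearIsometryEquiv.inner_map_map`).  So `R` maps `T ∩ B(q,r)` into `T ∩ B(e₀,r)`
(`arccos(⟨y',q'⟩)² ≤ arccos(⟨y',q'⟩)² + q₅² ≤ r²`; the image is the geodesic cap of `T` of angular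
radius `√(r² - q₅²) ≤ r` about `e₀`, or empty), and isometries preserve `μH⁴`
(`Isometry.hausdorffMeasure_image`), whence the claim by `measure_mono`.  The two coordinate
identities for `e₀` (`∑_{i<5} yᵢ (e₀)ᵢ = y₀`, `(e₀)₅ = 0`) are reused from the landed stub file
`CylinderEntropyThinCrossSectionExistsStubKernelDomination` (namespace `KernelDomination`).

Everything here is proved; no facts and no `Prop`-valued definitions are introduced.
-/

noncomputable section

open scoped BigOperators Topology MeasureTheory ENNReal NNReal RealInnerProductSpace
open Set Function MeasureTheory
open Literature.Geometry.Riemannian.SphericalCylinderEntropy (cylEntropy cylDensity cylKernel zonal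
  wt gegen cylKernel_eq abs_sum_mul_le_one hausdorffMeasure_sphere_four_pos
  hausdorffMeasure_sphere_four_lt_top)
open Literature.Geometry.Manifold.CylinderSlice (sliceMap range_sliceMap castSucc_ne_five)

set_option linter.dupNamespace false

namespace Summit.SmoothPoincare4.SmoothPoincare4.Theorems.ThinCrossSectionExists.BallMassSlack

namespace SliceBallMass

/-- The last index of `Fin 6` is `5`. [folklore] -/
theorem last_five_eq : (Fin.last 5 : Fin 6) = 5 := rfl

/-- `⟪y, e₅⟫ = y₅` in `ℝ⁶`. [folklore] -/
theorem inner_single_five (y : EuclideanSpace ℝ (Fin 6)) :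
    ⟪y, (EuclideanSpace.single 5 1 : EuclideanSpace ℝ (Fin 6))⟫ = y 5 := by
  rw [EuclideanSpace.inner_single_right]
  simp

/-- `⟪y, e₀⟫ = y₀` in `ℝ⁶`. [folklore] -/
theorem inner_single_zero (y : EuclideanSpace ℝ (Fin 6)) :
    ⟪y, (EuclideanSpace.single 0 1 : EuclideanSpace ℝ (Fin 6))⟫ = y 0 := by
  rw [EuclideanSpace.inner_single_right]
  simp

/-- `∑_{i<5} yᵢ² = ‖y‖² - y₅²` in `ℝ⁶`. [folklore] -/
theorem sum_sq_castSucc_eq (y : EuclideanSpace ℝ (Fin 6)) :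
    ∑ i : Fin 5, y (Fin.castSucc i) ^ 2 = ‖y‖ ^ 2 - y 5 ^ 2 := by
  rw [EuclideanSpace.real_norm_sq_eq, Fin.sum_univ_castSucc (f := fun j : Fin 6 => y j ^ 2),
    last_five_eq]
  ring

/-- The inner product with the foot point `v = q - q₅ e₅` of `q` on the slice is the base pairing
`⟨y', q'⟩ = ∑_{i<5} yᵢ qᵢ`. [folklore] -/
theorem inner_foot_eq (y q : EuclideanSpace ℝ (Fin 6)) :
    ⟪y, q - EuclideanSpace.single 5 (q 5)⟫ =
      ∑ i : Fin 5, y (Fin.castSucc i) * q (Fin.castSucc i) := by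
  rw [inner_sub_right, EuclideanSpace.inner_single_right]
  simp only [PiLp.inner_apply, RCLike.inner_apply, conj_trivial, Fin.sum_univ_castSucc,
    last_five_eq]
  ring

/-- The foot point `v = q - q₅ e₅` has the first five coordinates of `q`. [folklore] -/
theorem foot_apply_castSucc (q : EuclideanSpace ℝ (Fin 6)) (i : Fin 5) :
    (q - EuclideanSpace.single 5 (q 5) : EuclideanSpace ℝ (Fin 6)) (Fin.castSucc i) =
      q (Fin.castSucc i) := by
  simp [castSucc_ne_five i]

/-- The foot point `v = q - q₅ e₅` lies on the slice: `v₅ = 0`. [folklore] -/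
theorem foot_apply_five (q : EuclideanSpace ℝ (Fin 6)) :
    (q - EuclideanSpace.single 5 (q 5) : EuclideanSpace ℝ (Fin 6)) 5 = 0 := by
  simp

/-- For `q ∈ N` the foot point `v = q - q₅ e₅` is a unit vector of `ℝ⁶`. [folklore] -/
theorem norm_foot_eq_one {q : EuclideanSpace ℝ (Fin 6)}
    (hq : ∑ i : Fin 5, q (Fin.castSucc i) ^ 2 = 1) : ‖q - EuclideanSpace.single 5 (q 5)‖ = 1 := by
  have h := sum_sq_castSucc_eq (q - EuclideanSpace.single 5 (q 5))
  simp only [foot_apply_castSucc, foot_apply_five, hq] at h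
  have h2 : ‖q - EuclideanSpace.single 5 (q 5)‖ ^ 2 = 1 := by linarith
  rw [← abs_of_nonneg (norm_nonneg (q - EuclideanSpace.single 5 (q 5))), ← Real.sqrt_sq_eq_abs,
    h2, Real.sqrt_one]

/-- An isometry of `ℝ⁶` mapping `A` into `B` gives `μH⁴(A) ≤ μH⁴(B)` (isometry invariance and
monotonicity of the Hausdorff measure). [folklore] -/
theorem hausdorffMeasure_le_of_mapsTo {Φ : EuclideanSpace ℝ (Fin 6) → EuclideanSpace ℝ (Fin 6)}
    (hΦ : Isometry Φ) {A B : Set (EuclideanSpace ℝ (Fin 6))} (h : MapsTo Φ A B) :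
    μH[4] A ≤ μH[4] B :=
  calc μH[4] A = μH[4] (Φ '' A) := (hΦ.hausdorffMeasure_image (Or.inl (by norm_num)) A).symm
    _ ≤ μH[4] B := measure_mono h.image_subset

/-- **The rotation.**  For `q ∈ N` there is a linear isometry `R` of `ℝ⁶` preserving heights,
preserving membership in `N`, and turning the base pairing with `q'` into the first coordinate:
`(R y)₅ = y₅`, `∑_{i<5} (R y)ᵢ² = ∑_{i<5} yᵢ²`, `(R y)₀ = ∑_{i<5} yᵢ qᵢ`.  It is the reflection
of `ℝ⁶` in the hyperplane `(v - e₀)ᗮ`, `v = q - q₅ e₅` (`Submodule.reflection_sub`). [folklore] -/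
theorem exists_rotation {q : EuclideanSpace ℝ (Fin 6)}
    (hq : ∑ i : Fin 5, q (Fin.castSucc i) ^ 2 = 1) :
    ∃ R : EuclideanSpace ℝ (Fin 6) ≃ₗᵢ[ℝ] EuclideanSpace ℝ (Fin 6),
      (∀ y, R y 5 = y 5) ∧
      (∀ y, ∑ i : Fin 5, R y (Fin.castSucc i) ^ 2 = ∑ i : Fin 5, y (Fin.castSucc i) ^ 2) ∧
      (∀ y, R y 0 = ∑ i : Fin 5, y (Fin.castSucc i) * q (Fin.castSucc i)) := by
  set v : EuclideanSpace ℝ (Fin 6) := q - EuclideanSpace.single 5 (q 5) with hv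
  set e₀ : EuclideanSpace ℝ (Fin 6) := EuclideanSpace.single 0 1 with he₀
  have hnorm : ‖v‖ = ‖e₀‖ := by
    rw [norm_foot_eq_one hq, he₀, PiLp.norm_single, norm_one]
  set R : EuclideanSpace ℝ (Fin 6) ≃ₗᵢ[ℝ] EuclideanSpace ℝ (Fin 6) := (ℝ ∙ (v - e₀))ᗮ.reflection
    with hR
  have hRv : R v = e₀ := Submodule.reflection_sub hnorm
  have hRaxis : R (EuclideanSpace.single 5 1) = EuclideanSpace.single 5 1 := by
    refine Submodule.reflection_mem_subspace_eq_self ?_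
    rw [Submodule.mem_orthogonal_singleton_iff_inner_right, inner_single_five]
    simp [hv, he₀]
  have h5 : ∀ y, R y 5 = y 5 := fun y => by
    rw [← inner_single_five (R y), ← inner_single_five y]
    conv_lhs => rw [← hRaxis]
    exact R.inner_map_map y _
  refine ⟨R, h5, fun y => ?_, fun y => ?_⟩
  · rw [sum_sq_castSucc_eq, sum_sq_castSucc_eq, h5, LinearIsometryEquiv.norm_map]
  · rw [← inner_foot_eq, ← inner_single_zero (R y), ← he₀, ← hRv]
    exact R.inner_map_map y v

end SliceBallMass

open SliceBallMass in
/-- **`ballMass_slice_le`** (the `M = S⁴` instance of stub D `stub_massSlackIntr`: the unit slice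
`S⁴ × {0}` has `1`-subspherical intrinsic ball mass).  For every `q ∈ N = S⁴ × ℝ` and `r > 0`, the
part of the slice `T = {z ∈ N | z₅ = 0}` inside the closed intrinsic ball `B(q,r)` has
`μH⁴`-measure at most that of the part inside `B(e₀,r)`, `e₀ = (1,0,0,0,0,0)`: a reflection of `ℝ⁶`
fixing the axis `e₅` and taking the foot point `q - q₅ e₅` to `e₀` moves `T ∩ B(q,r)` (a geodesic
cap of `T` of angular radius `√(r² - q₅²) ≤ r`, or nothing) into the cap `T ∩ B(e₀,r)`, and `μH⁴`
is isometry invariant (`SliceBallMass.exists_rotation`, `Isometry.hausdorffMeasure_image`,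
`measure_mono`; the coordinate identities for `e₀` are those of the landed stub file
`…StubKernelDomination`). [folklore] -/
theorem ballMass_slice_le :
    ∀ q : EuclideanSpace ℝ (Fin 6), ∑ i : Fin 5, q (Fin.castSucc i) ^ 2 = 1 → ∀ r : ℝ, 0 < r →
      μH[4] ({z : EuclideanSpace ℝ (Fin 6) | ∑ i : Fin 5, z (Fin.castSucc i) ^ 2 = 1 ∧ z 5 = 0} ∩ {y : EuclideanSpace ℝ (Fin 6) | ∑ i : Fin 5, y (Fin.castSucc i) ^ 2 = 1 ∧ Real.arccos (∑ i : Fin 5, y (Fin.castSucc i) * q (Fin.castSucc i)) ^ 2 + (y 5 - q 5) ^ 2 ≤ r ^ 2}) ≤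
        μH[4] ({z : EuclideanSpace ℝ (Fin 6) | ∑ i : Fin 5, z (Fin.castSucc i) ^ 2 = 1 ∧ z 5 = 0} ∩
          {y : EuclideanSpace ℝ (Fin 6) | ∑ i : Fin 5, y (Fin.castSucc i) ^ 2 = 1 ∧ Real.arccos (∑ i : Fin 5, y (Fin.castSucc i) * (EuclideanSpace.single 0 1 : EuclideanSpace ℝ (Fin 6)) (Fin.castSucc i)) ^ 2 + (y 5 - (EuclideanSpace.single 0 1 : EuclideanSpace ℝ (Fin 6)) 5) ^ 2 ≤ r ^ 2}) := by
  intro q hq r _hr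
  obtain ⟨R, h5, hN, h0⟩ := exists_rotation hq
  refine hausdorffMeasure_le_of_mapsTo R.isometry ?_
  rintro y ⟨⟨hyN, hy5⟩, -, hyB⟩
  refine ⟨⟨by rw [hN, hyN], by rw [h5, hy5]⟩, by rw [hN, hyN], ?_⟩
  rw [KernelDomination.sum_mul_single_zero, KernelDomination.single_zero_apply_five, h0, h5, hy5]
  rw [hy5] at hyB
  nlinarith [sq_nonneg (q 5)]

end Summit.SmoothPoincare4.SmoothPoincare4.Theorems.ThinCrossSectionExists.BallMassSlack
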